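import Mathlib
import HarnessLib

/-!
# `NoHeavyLowerTail` (stmt-CriticalPhenomena-4575) — class-words over several classes: exact mass

Support file (prover `prim-gen-swap` gen 11; `--supports stmt-CriticalPhenomena-4575`).  No definitions, no named facts, no sorries.

B1c of the Lean blueprint in the seat memo U1-PROOF.md §11.  Hair patterns `e : Fin m → Fin 3`, coefficients `Π_i c_i(e_i)`, a class map
`cls : Fin m → κ`, a finite set `T` of classes and prescribed nonzero values `k_i`.  The CLASS-WORD `(T,k)` is the set of patterns whose glued
stars are exactly distributed over the classes of `T` — no star outside `T` glued, glued stars of `T` take their prescribed value, and every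
class of `T` has at least one glued star.  Its mass factorises:
`Σ_{e ∈ word(T,k)} Π_i c_i(e_i) = Π_{i : cls i ∉ T} c_i(0) · Π_{X∈T} (Π_{cls i = X}(c_i(0)+c_i(k_i)) − Π_{cls i = X} c_i(0))`.
With `StarSet.classWeight_mul_prod_coeffZero_le` each factor is `≥ t_X·Π_{cls i = X} c_i(0)`, giving the bound "`mass ≥ C0·Π_X t_X`" of U1-PROOF.md L1.1,
and with `StarSet.classOdds_mul_ge_sq_sum_phi` / `StarSet.two_mul_prod_le_prod_add_prod` the balanced-pair bound L1.4.

* `StarSet.prod_ite_mem_eq_mul` — `Π_{i∈S} c_i(if i∈A then k_i else 0) = Π_A c(k) · Π_{S∖A} c(0)` for `A ⊆ S`;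
* `StarSet.sum_powerset_erase_empty_eq` — `Σ_{∅ ≠ A ⊆ S} Π_{i∈S} c_i(…) = Π_S (c(0)+c(k)) − Π_S c(0)`;
* `StarSet.sum_patterns_classWord_eq` — the factorisation above.
-/

namespace Summit.CriticalPhenomena.PercolationContinuityZ3.Theorems

open Finset
open scoped BigOperators

namespace StarSet

variable {m : ℕ}

/-- Product over a star set of the coefficients of the sub-pattern "`k` on `A`, `0` on `S ∖ A`". -/
theorem prod_ite_mem_eq_mul (c : Fin m → Fin 3 → ℝ) (k : Fin m → Fin 3) (S A : Finset (Fin m)) (hA : A ⊆ S) :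
    ∏ i ∈ S, c i (if i ∈ A then k i else 0) = (∏ i ∈ A, c i (k i)) * ∏ i ∈ S \ A, c i 0 := by
  classical
  rw [← prod_sdiff hA, mul_comm]
  congr 1
  · exact prod_congr rfl fun i hi => by rw [if_pos hi]
  · exact prod_congr rfl fun i hi => by rw [if_neg (mem_sdiff.1 hi).2]

/-- The nonempty sub-patterns on a star set `S` with prescribed values weigh `Π_S(c(0)+c(k)) − Π_S c(0)`. -/
theorem sum_powerset_erase_empty_eq (c : Fin m → Fin 3 → ℝ) (k : Fin m → Fin 3) (S : Finset (Fin m)) :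
    ∑ A ∈ S.powerset.erase ∅, ∏ i ∈ S, c i (if i ∈ A then k i else 0) =
      (∏ i ∈ S, (c i 0 + c i (k i))) - ∏ i ∈ S, c i 0 := by
  classical
  have hfull : ∑ A ∈ S.powerset, ∏ i ∈ S, c i (if i ∈ A then k i else 0) = ∏ i ∈ S, (c i 0 + c i (k i)) := by
    have hcomm : ∏ i ∈ S, (c i 0 + c i (k i)) = ∏ i ∈ S, (c i (k i) + c i 0) := prod_congr rfl fun i _ => add_comm _ _
    rw [hcomm, prod_add]
    exact sum_congr rfl fun A hA => prod_ite_mem_eq_mul c k S A (mem_powerset.1 hA)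
  have hmem : (∅ : Finset (Fin m)) ∈ S.powerset := mem_powerset.2 (empty_subset S)
  rw [sum_erase_eq_sub hmem, hfull]
  simp

/-- **Mass of a class-word (several classes).**  See the file header. [U1-PROOF.md §1 / §11 B1c] -/
theorem sum_patterns_classWord_eq {κ : Type*} [DecidableEq κ] (cls : Fin m → κ) (k : Fin m → Fin 3) (hk : ∀ i, k i ≠ 0)
    (T : Finset κ) (c : Fin m → Fin 3 → ℝ) :
    ∑ e ∈ (univ : Finset (Fin m → Fin 3)).filter (fun e =>
        (∀ i, cls i ∉ T → e i = 0) ∧ (∀ i, cls i ∈ T → (e i = 0 ∨ e i = k i)) ∧ (∀ X ∈ T, ∃ i, cls i = X ∧ e i ≠ 0)),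
        ∏ i, c i (e i) =
      (∏ i ∈ univ.filter (fun i => cls i ∉ T), c i 0) *
        ∏ X ∈ T, ((∏ i ∈ univ.filter (fun i => cls i = X), (c i 0 + c i (k i))) - ∏ i ∈ univ.filter (fun i => cls i = X), c i 0) := by
  classical
  induction T using Finset.induction_on generalizing c with
  | empty =>
    have hset : (univ : Finset (Fin m → Fin 3)).filter (fun e =>
        (∀ i, cls i ∉ (∅ : Finset κ) → e i = 0) ∧ (∀ i, cls i ∈ (∅ : Finset κ) → (e i = 0 ∨ e i = k i)) ∧
          (∀ X ∈ (∅ : Finset κ), ∃ i, cls i = X ∧ e i ≠ 0)) = {fun _ => 0} := by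
      ext e
      simp only [mem_filter, mem_univ, true_and, notMem_empty, not_false_eq_true, forall_const, IsEmpty.forall_iff,
        implies_true, and_true, mem_singleton]
      constructor
      · intro h; funext i; exact h i
      · intro h i; rw [h]
    rw [hset, sum_singleton, prod_empty, mul_one]
    exact (prod_congr (by ext i; simp) fun _ _ => rfl).symm
  | insert X T hX ih =>
    -- notation
    set S : Finset (Fin m) := univ.filter (fun i => cls i = X) with hS
    set ET := (univ : Finset (Fin m → Fin 3)).filter (fun e =>
        (∀ i, cls i ∉ T → e i = 0) ∧ (∀ i, cls i ∈ T → (e i = 0 ∨ e i = k i)) ∧ (∀ Y ∈ T, ∃ i, cls i = Y ∧ e i ≠ 0)) with hET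
    set EX := (univ : Finset (Fin m → Fin 3)).filter (fun e =>
        (∀ i, cls i ∉ insert X T → e i = 0) ∧ (∀ i, cls i ∈ insert X T → (e i = 0 ∨ e i = k i)) ∧
          (∀ Y ∈ insert X T, ∃ i, cls i = Y ∧ e i ≠ 0)) with hEX
    set P := S.powerset.erase ∅ with hP
    -- merge / split
    set mg : (Fin m → Fin 3) × Finset (Fin m) → (Fin m → Fin 3) :=
      fun q => fun i => if cls i = X then (if i ∈ q.2 then k i else 0) else q.1 i with hmg
    set sp : (Fin m → Fin 3) → (Fin m → Fin 3) × Finset (Fin m) :=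
      fun e => (fun i => if cls i = X then 0 else e i, S.filter fun i => e i ≠ 0) with hsp
    have hmemS : ∀ i, i ∈ S ↔ cls i = X := fun i => by simp [hS]
    -- (1) re-index the sum over `EX` by `ET ×ˢ P`
    have hbij : ∑ e ∈ EX, ∏ i, c i (e i) = ∑ q ∈ ET ×ˢ P, ∏ i, c i (mg q i) := by
      refine sum_nbij' sp mg ?_ ?_ ?_ ?_ ?_
      · -- sp maps EX into ET ×ˢ P
        intro e he
        simp only [hEX, mem_filter, mem_univ, true_and] at he
        obtain ⟨h1, h2, h3⟩ := he
        simp only [hsp, mem_product, hET, hP, mem_filter, mem_univ, true_and, mem_erase, mem_powerset]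
        refine ⟨⟨fun i hi => ?_, fun i hi => ?_, fun Y hY => ?_⟩, ?_, filter_subset _ _⟩
        · by_cases hc : cls i = X
          · rw [if_pos hc]
          · rw [if_neg hc]; exact h1 i (by simp [hc, hi])
        · have hc : cls i ≠ X := fun h => hX (h ▸ hi)
          rw [if_neg hc]; exact h2 i (mem_insert_of_mem hi)
        · obtain ⟨i, hi, hne⟩ := h3 Y (mem_insert_of_mem hY)
          refine ⟨i, hi, ?_⟩
          have hc : cls i ≠ X := fun h => hX (h ▸ hi ▸ hY)
          rw [if_neg hc]; exact hne
        · obtain ⟨i, hi, hne⟩ := h3 X (mem_insert_self X T)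
          intro hempty
          have : i ∈ S.filter (fun i => e i ≠ 0) := mem_filter.2 ⟨(hmemS i).2 hi, hne⟩
          rw [hempty] at this
          exact notMem_empty i this
      · -- mg maps ET ×ˢ P into EX
        rintro ⟨e', A⟩ hq
        simp only [mem_product, hET, hP, mem_filter, mem_univ, true_and, mem_erase, mem_powerset] at hq
        obtain ⟨⟨h1, h2, h3⟩, hA0, hAS⟩ := hq
        simp only [hEX, mem_filter, mem_univ, true_and, hmg]
        refine ⟨fun i hi => ?_, fun i hi => ?_, fun Y hY => ?_⟩
        · have hc : cls i ≠ X := fun h => hi (h ▸ mem_insert_self X T)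
          rw [if_neg hc]; exact h1 i fun h => hi (mem_insert_of_mem h)
        · by_cases hc : cls i = X
          · rw [if_pos hc]; by_cases hiA : i ∈ A
            · exact Or.inr (by rw [if_pos hiA])
            · exact Or.inl (by rw [if_neg hiA])
          · rw [if_neg hc]; exact h2 i ((mem_insert.1 hi).resolve_left hc)
        · rcases mem_insert.1 hY with rfl | hYT
          · obtain ⟨i, hiA⟩ := nonempty_iff_ne_empty.2 hA0
            refine ⟨i, (hmemS i).1 (hAS hiA), ?_⟩
            rw [if_pos ((hmemS i).1 (hAS hiA)), if_pos hiA]; exact hk i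
          · obtain ⟨i, hi, hne⟩ := h3 Y hYT
            refine ⟨i, hi, ?_⟩
            have hc : cls i ≠ X := fun h => hX (h ▸ hi ▸ hYT)
            rw [if_neg hc]; exact hne
      · -- left inverse: mg (sp e) = e
        intro e he
        simp only [hEX, mem_filter, mem_univ, true_and] at he
        obtain ⟨h1, h2, h3⟩ := he
        funext i
        simp only [hmg, hsp]
        by_cases hc : cls i = X
        · rw [if_pos hc]
          by_cases h0 : e i = 0
          · rw [if_neg (by simp [mem_filter, h0]), h0]
          · rw [if_pos (mem_filter.2 ⟨(hmemS i).2 hc, h0⟩)]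
            exact ((h2 i (by rw [hc]; exact mem_insert_self X T)).resolve_left h0).symm
        · rw [if_neg hc, if_neg hc]
      · -- right inverse: sp (mg q) = q
        rintro ⟨e', A⟩ hq
        simp only [mem_product, hET, hP, mem_filter, mem_univ, true_and, mem_erase, mem_powerset] at hq
        obtain ⟨⟨h1, h2, h3⟩, hA0, hAS⟩ := hq
        simp only [hsp, hmg, Prod.mk.injEq]
        constructor
        · funext i
          by_cases hc : cls i = X
          · rw [if_pos hc]; exact (h1 i fun h => hX (hc ▸ h)).symm
          · rw [if_neg hc, if_neg hc]
        · ext i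
          simp only [mem_filter]
          constructor
          · rintro ⟨hiS, hne⟩
            rw [if_pos ((hmemS i).1 hiS)] at hne
            by_contra hiA
            exact hne (by rw [if_neg hiA])
          · intro hiA
            refine ⟨hAS hiA, ?_⟩
            rw [if_pos ((hmemS i).1 (hAS hiA)), if_pos hiA]; exact hk i
      · -- summands agree
        intro e he
        simp only [hEX, mem_filter, mem_univ, true_and] at he
        obtain ⟨h1, h2, h3⟩ := he
        refine prod_congr rfl fun i _ => ?_
        simp only [hmg, hsp]
        by_cases hc : cls i = X
        · rw [if_pos hc]
          by_cases h0 : e i = 0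
          · rw [if_neg (by simp [mem_filter, h0]), h0]
          · rw [if_pos (mem_filter.2 ⟨(hmemS i).2 hc, h0⟩)]
            exact congrArg _ ((h2 i (by rw [hc]; exact mem_insert_self X T)).resolve_left h0)
        · rw [if_neg hc, if_neg hc]
    -- (2) the weight of a merged pattern splits off the class `X`
    have hsplit : ∀ q : (Fin m → Fin 3) × Finset (Fin m),
        ∏ i, c i (mg q i) = (∏ i ∈ univ.filter (fun i => ¬ cls i = X), c i (q.1 i)) * ∏ i ∈ S, c i (if i ∈ q.2 then k i else 0) := by
      intro q
      rw [← prod_filter_mul_prod_filter_not univ (fun i => ¬ cls i = X)]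
      congr 1
      · exact prod_congr rfl fun i hi => by simp only [hmg]; rw [if_neg (mem_filter.1 hi).2]
      · refine prod_congr (by ext i; simp only [mem_filter, mem_univ, true_and, not_not, hmemS]) fun i hi => ?_
        have hc : cls i = X := (hmemS i).1 hi
        simp only [hmg]; rw [if_pos hc]
    -- (3) induction hypothesis for the coefficients switched off on the class `X`
    set c' : Fin m → Fin 3 → ℝ := fun i v => if cls i = X then 1 else c i v with hc'
    have hih := ih c'
    have hc'prod : ∀ e' : Fin m → Fin 3, ∏ i, c' i (e' i) = ∏ i ∈ univ.filter (fun i => ¬ cls i = X), c i (e' i) := by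
      intro e'
      rw [prod_filter]
      refine prod_congr rfl fun i _ => ?_
      by_cases hc : cls i = X <;> simp [hc', hc]
    have hc'0 : ∏ i ∈ univ.filter (fun i => cls i ∉ T), c' i 0 = ∏ i ∈ univ.filter (fun i => cls i ∉ insert X T), c i 0 := by
      have hsets : univ.filter (fun i => cls i ∉ insert X T) = (univ.filter (fun i => cls i ∉ T)).filter (fun i => ¬ cls i = X) := by
        ext i; simp [mem_insert, not_or, and_comm]
      conv_rhs => rw [hsets, prod_filter]
      refine prod_congr rfl fun i _ => ?_
      by_cases hc : cls i = X <;> simp [hc', hc]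
    have hc'T : ∀ Y ∈ T, ((∏ i ∈ univ.filter (fun i => cls i = Y), (c' i 0 + c' i (k i))) - ∏ i ∈ univ.filter (fun i => cls i = Y), c' i 0) =
        ((∏ i ∈ univ.filter (fun i => cls i = Y), (c i 0 + c i (k i))) - ∏ i ∈ univ.filter (fun i => cls i = Y), c i 0) := by
      intro Y hY
      have hne : ∀ i ∈ univ.filter (fun i => cls i = Y), cls i ≠ X := fun i hi h => hX (h ▸ (mem_filter.1 hi).2 ▸ hY)
      congr 1
      · exact prod_congr rfl fun i hi => by simp only [hc', if_neg (hne i hi)]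
      · exact prod_congr rfl fun i hi => by simp only [hc', if_neg (hne i hi)]
    -- (4) assemble
    rw [hbij, sum_product]
    have hinner : ∀ e' : Fin m → Fin 3, ∑ A ∈ P, ∏ i, c i (mg (e', A) i) =
        (∏ i ∈ univ.filter (fun i => ¬ cls i = X), c i (e' i)) * ((∏ i ∈ S, (c i 0 + c i (k i))) - ∏ i ∈ S, c i 0) := by
      intro e'
      rw [← sum_powerset_erase_empty_eq c k S, mul_sum]
      exact sum_congr rfl fun A _ => hsplit (e', A)
    rw [sum_congr rfl fun e' _ => hinner e', ← sum_mul]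
    rw [show ∑ e' ∈ ET, ∏ i ∈ univ.filter (fun i => ¬ cls i = X), c i (e' i) = ∑ e' ∈ ET, ∏ i, c' i (e' i) from
      sum_congr rfl fun e' _ => (hc'prod e').symm]
    rw [hih, hc'0, prod_insert hX, prod_congr rfl hc'T]
    ring

end StarSet

end Summit.CriticalPhenomena.PercolationContinuityZ3.Theorems
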